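import Summits.HodgeConjecture.HodgeConjecture.Theorems.F0P3bU2PrincipalSeriesJacquetRankLeTwo  -- ★ p842409 H1′: `finrank r_B i(χ) ≤ 2` for `U(Φ₂)(L⁺_v)`
import Literature.NumberTheory.Automorphic.ConstituentsPairOfCharacterQuotient                 -- ★ p842410: GENERIC `exists_constituents_pair_of_quotient_char`
import Literature.NumberTheory.Automorphic.UnitaryGroupPrincipalSeriesH                        -- ★ `cmPrincipalSeriesH` vocabulary (the `U(Φ₁)` factor carrier)
import Literature.NumberTheory.Rogawski1990.XiLocalCharacter                                   -- ★ `OneDimAutRepH.xiLocalChar`, `xiLocalChar_apply_eq`, `localDet`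
import HarnessLib

/-!
# (JH₂) for `i(χH₂)` on `U(Φ₂)(L⁺_v)` FROM THREE BRICKS: Harish-Chandra (H3), the `ξ₂`-quotient (H4), no `ξ₂`-eigenvector (EIG)

Cell hodgecm-mathlib (FLOOR 0), crux `H413` = `stmt-HodgeConjecture-24833`, line «CMCharIdentityTest»
(`Cruxes/H413/Lines/F0_P3b_CMCharIdentityTestPaydown.lean`, ED. 11), joint (N-H-ii′) `stub_hPrincipalSeriesJH` ⟸ (JH₂) (★ p842330
`F0P3bHPrincipalSeriesJHOfUTwo.hPrincipalSeriesJH_of_uTwo`; the desk's announced ED. 12 registers `stub_uTwoPrincipalSeriesJH : JH₂`).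
THIS FILE (theorems only; no `def`, no named fact, no `sorry`) is the JUNCTION **`uTwoPrincipalSeriesJH_of_bricks (hHC) (hQ) (hEig) : JH₂`** —
the (JH₂) text VERBATIM (= the binder of ★ `hPrincipalSeriesJH_of_uTwo`) from THREE theorem-world statements about `G₂ = U(Φ₂)(L⁺_v)` at a
non-split `v` (each a print sentence, each sized for one hand), over ★ H1′ `finiteDimensional_finrank_coinvariants_cmPrincipalSeries_two_le_two`
(`finrank r_B i(χ) ≤ 2`) and the ★ GENERIC assembly `IrrClass.exists_constituents_pair_of_quotient_char`:
* (H3) `hHC` — «every irreducible constituent of `i(χ)` has a non-zero Jacquet module» (Harish-Chandra∕Casselman: a constituent with `r_B = 0`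
  would be supercuspidal, hence a direct summand, contradicting Frobenius reciprocity), for EVERY character `χ` of `T₂(L⁺_v)`
  [Casselman1995 Thm. 5.3.1 + Cor. 6.3.9; BernsteinZelevinsky1977 Thm. 2.4 (b), 2.9; Rogawski1990 §12.2 p. 173 for `U(3)` = ★ N6];
* (H4) `hQ` — «`ξ₂ = (η_v ψ_v) ∘ det` is a QUOTIENT of `i(χH₂)`»: a non-zero linear functional `q` on `i(χH₂)` with `q (g·f) = ξ₂(g) q(f)`
  (the `G`-invariant `K`-integral on `Ind_B^G δ_B`, twisted by `ξ₂`; `χH₂ = ξ₂|_{T₂} · δ_{B₂}^{1∕2}`) [Rogawski1990 §12.1 case (1): «`ξ ∈ JH(i_H(χ))`»;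
  Casselman1995 §3.1, Prop. 6.4.1; BernsteinZelevinsky1977 §2.3];
* (EIG) `hEig` — «`ξ₂` is NOT a subrepresentation of `i(χH₂)`»: no non-zero `f ∈ i(χH₂)` with `g·f = ξ₂(g) f` for all `g` (such an `f` is
  `f(1)·ξ₂`, and `f(b) = χH₂(b) δ_{B₂}^{1∕2}(b) f(1)` on `B₂` forces `δ_{B₂} ≡ 1`, false: `δ_{B₂}(d(α, ᾱ⁻¹)) = ‖α‖`) [Rogawski1990 §12.1; Casselman1995
  Prop. 6.4.1].
Inside: `ξ₂` of (JH₂) is `(ξ.xiLocalChar v).comp inl`; on `g ∈ G₂` it equals `η_v(det g) · ψ_v(det g)` (★ `xiLocalChar_apply_eq` at `(g, 1)`, `det₁ 1 = 1`),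
the spelling of (H4)∕(EIG).  HONEST LABEL: HC_CM is proved only modulo the 2 remaining named inputs (hLiu418, h413) until rung 0 closes; (H3), (H4),
(EIG) are NOT proved here.

## References
* [Rogawski1990] J. D. Rogawski, *Automorphic Representations of Unitary Groups in Three Variables* (1990), §12.1 case (1) pp. 171–172, §12.2 p. 173.
* [Casselman1995] W. Casselman, *Introduction to the theory of admissible representations of p-adic reductive groups* (1995), §3.1, Thm. 5.3.1,
  Prop. 6.4.1, Cor. 6.3.9, §7.1.
* [BernsteinZelevinsky1977] I. N. Bernstein, A. V. Zelevinsky, Ann. Sci. ÉNS 10 (1977), §2.3, Thm. 2.4, Thm. 2.9.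
-/

set_option autoImplicit false
set_option linter.dupNamespace false

noncomputable section

open NumberField IsDedekindDomain
open scoped Matrix MatrixGroups
open Literature.NumberTheory.Rogawski1990 Literature.NumberTheory.Automorphic Literature.NumberTheory.Automorphic.UnitaryGroup
open Literature.NumberTheory.GaloisRepresentations

namespace Summit.HodgeConjecture.HodgeConjecture.Cruxes.H413.F0P3bU2PrincipalSeriesJHOfBricks

open Summit.HodgeConjecture.HodgeConjecture.Cruxes.H413.F0P3bU2PrincipalSeriesJacquetRankLeTwo

set_option synthInstance.maxHeartbeats 400000 in  -- instance paths on the CM carriers (as ★ `isAdmissible_cmPrincipalSeriesH`)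
set_option maxHeartbeats 1600000 in  -- statement-level `whnf` on the two carrier spellings of `U(Φ₂)_v` + the `cmPrincipalSeries = normalizedInd` bridge
/-- **(JH₂) ⟸ (H3) + (H4) + (EIG)** over ★ H1′ and the ★ generic assembly (see the module docstring): for every CM `L`, finite `v` NON-SPLIT in `L`,
one-dimensional `ξ = (η, ψ)` and every proof `hξ₂` that `ξ₂ := ξ_v ∘ inl` has open kernel, there is `πSt₂ ≠ ⟦ℂ_{ξ₂}⟧` with
`JH(i(χH₂)) = {⟦ℂ_{ξ₂}⟧, πSt₂}` exactly and no chain `⊥ < N₁ < N₂ < ⊤` in `i(χH₂)` — the conclusion is the binder of ★ `hPrincipalSeriesJH_of_uTwo` VERBATIM.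
[cite: Rogawski1990, §12.1 case (1) pp. 171–172] [cite: Casselman1995, §7.1 Cor. 7.1.2] -/
theorem uTwoPrincipalSeriesJH_of_bricks
    (hHC : ∀ (L : Type) [Field L] [NumberField L] [IsCMField L] (v : HeightOneSpectrum (𝓞 ↥(maximalRealSubfield L))),
      (∀ w : PlacesOver L v, IsCMField.complexConj L • w.1 = w.1) →
      ∀ (χ : ↥(torusU (conjLocal L (IsCMField.complexConj L) v) (cmLocalForm L 2 v)) →* ℂˣ)
        (c : IrrClass ↥(unitaryGroupOfForm (conjLocal L (IsCMField.complexConj L) v) (cmLocalForm L 2 v))),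
        c.IsConstituentOf (haveI := locallyCompactSpace_cmBorelU L 2 v; cmPrincipalSeries L 2 v χ) →
        ∃ r : SmoothIrrep ↥(unitaryGroupOfForm (conjLocal L (IsCMField.complexConj L) v) (cmLocalForm L 2 v)),
          IrrClass.mk r = c ∧ Nontrivial ((cmBorelTriple L 2 v).restrict r.ρ).Coinvariants)
    (hQ : ∀ (L : Type) [Field L] [NumberField L] [IsCMField L] (v : HeightOneSpectrum (𝓞 ↥(maximalRealSubfield L))) (ξ : OneDimAutRepH L),
      (∀ w : PlacesOver L v, IsCMField.complexConj L • w.1 = w.1) →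
      haveI := locallyCompactSpace_cmBorelU L 2 v
      ∃ q : Representation.SmoothInd (cmBorelTriple L 2 v).P
          (Representation.twist
            (((Representation.trivial ℂ ↥(torusU (conjLocal L (IsCMField.complexConj L) v) (cmLocalForm L 2 v)) ℂ).twist
              (torusCharPair (conjLocal L (IsCMField.complexConj L) v) (cmLocalForm L 2 v) (cmLocalForm_eq_over L 2 v) 0
                ((torusLocalComponent L (IsCMField.complexConj L) v ξ.η).comp
                    (quotConj (conjLocal L (IsCMField.complexConj L) v) (conjLocal_conjLocal_cm L v)) *
                  halfModulusChar (UnitaryGroup.LocalRing L v))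
                (torusLocalComponent L (IsCMField.complexConj L) v ξ.ψ))).comp (cmBorelTriple L 2 v).proj)
            (rootDeltaChar (cmBorelTriple L 2 v).P)) →ₗ[ℂ] ℂ,
        (∃ f, q f ≠ 0) ∧
        ∀ (g : ↥(unitaryGroupOfForm (conjLocal L (IsCMField.complexConj L) v) (cmLocalForm L 2 v))) (f : _),
          q (cmPrincipalSeries L 2 v
              (torusCharPair (conjLocal L (IsCMField.complexConj L) v) (cmLocalForm L 2 v) (cmLocalForm_eq_over L 2 v) 0
                ((torusLocalComponent L (IsCMField.complexConj L) v ξ.η).comp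
                    (quotConj (conjLocal L (IsCMField.complexConj L) v) (conjLocal_conjLocal_cm L v)) *
                  halfModulusChar (UnitaryGroup.LocalRing L v))
                (torusLocalComponent L (IsCMField.complexConj L) v ξ.ψ)) g f) =
            ((torusLocalComponent L (IsCMField.complexConj L) v ξ.η (localDet (IsCMField.complexConj L) v (isUnit_antidiagOne_det L 2) g) *
                torusLocalComponent L (IsCMField.complexConj L) v ξ.ψ (localDet (IsCMField.complexConj L) v (isUnit_antidiagOne_det L 2) g) : ℂˣ) : ℂ) *
              q f)
    (hEig : ∀ (L : Type) [Field L] [NumberField L] [IsCMField L] (v : HeightOneSpectrum (𝓞 ↥(maximalRealSubfield L))) (ξ : OneDimAutRepH L),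
      (∀ w : PlacesOver L v, IsCMField.complexConj L • w.1 = w.1) →
      haveI := locallyCompactSpace_cmBorelU L 2 v
      ∀ f : Representation.SmoothInd (cmBorelTriple L 2 v).P
          (Representation.twist
            (((Representation.trivial ℂ ↥(torusU (conjLocal L (IsCMField.complexConj L) v) (cmLocalForm L 2 v)) ℂ).twist
              (torusCharPair (conjLocal L (IsCMField.complexConj L) v) (cmLocalForm L 2 v) (cmLocalForm_eq_over L 2 v) 0
                ((torusLocalComponent L (IsCMField.complexConj L) v ξ.η).comp
                    (quotConj (conjLocal L (IsCMField.complexConj L) v) (conjLocal_conjLocal_cm L v)) *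
                  halfModulusChar (UnitaryGroup.LocalRing L v))
                (torusLocalComponent L (IsCMField.complexConj L) v ξ.ψ))).comp (cmBorelTriple L 2 v).proj)
            (rootDeltaChar (cmBorelTriple L 2 v).P)),
        (∀ g : ↥(unitaryGroupOfForm (conjLocal L (IsCMField.complexConj L) v) (cmLocalForm L 2 v)),
          cmPrincipalSeries L 2 v
              (torusCharPair (conjLocal L (IsCMField.complexConj L) v) (cmLocalForm L 2 v) (cmLocalForm_eq_over L 2 v) 0
                ((torusLocalComponent L (IsCMField.complexConj L) v ξ.η).comp
                    (quotConj (conjLocal L (IsCMField.complexConj L) v) (conjLocal_conjLocal_cm L v)) *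
                  halfModulusChar (UnitaryGroup.LocalRing L v))
                (torusLocalComponent L (IsCMField.complexConj L) v ξ.ψ)) g f =
            ((torusLocalComponent L (IsCMField.complexConj L) v ξ.η (localDet (IsCMField.complexConj L) v (isUnit_antidiagOne_det L 2) g) *
                torusLocalComponent L (IsCMField.complexConj L) v ξ.ψ (localDet (IsCMField.complexConj L) v (isUnit_antidiagOne_det L 2) g) : ℂˣ) : ℂ) • f) →
        f = 0) :
    ∀ (L : Type) [Field L] [NumberField L] [IsCMField L] (v : HeightOneSpectrum (𝓞 ↥(maximalRealSubfield L))) (ξ : OneDimAutRepH L),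
      (∀ w : PlacesOver L v, IsCMField.complexConj L • w.1 = w.1) →
      ∀ hξ₂ : IsOpen (((((ξ.xiLocalChar v).comp (MonoidHom.inl ((cmDatum L 2 (Matrix.of fun i j : Fin 2 => if i.val + j.val + 1 = 2 then (1 : L) else 0)).Local v) ((cmDatum L 1 (Matrix.of fun i j : Fin 1 => if i.val + j.val + 1 = 1 then (1 : L) else 0)).Local v))).ker :
          Subgroup ((cmDatum L 2 (Matrix.of fun i j : Fin 2 => if i.val + j.val + 1 = 2 then (1 : L) else 0)).Local v)) : Set ((cmDatum L 2 (Matrix.of fun i j : Fin 2 => if i.val + j.val + 1 = 2 then (1 : L) else 0)).Local v))),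
      ∃ πSt₂ : IrrClass ((cmDatum L 2 (Matrix.of fun i j : Fin 2 => if i.val + j.val + 1 = 2 then (1 : L) else 0)).Local v),
        πSt₂ ≠ IrrClass.mk (SmoothIrrep.ofChar ((ξ.xiLocalChar v).comp (MonoidHom.inl ((cmDatum L 2 (Matrix.of fun i j : Fin 2 => if i.val + j.val + 1 = 2 then (1 : L) else 0)).Local v) ((cmDatum L 1 (Matrix.of fun i j : Fin 1 => if i.val + j.val + 1 = 1 then (1 : L) else 0)).Local v))) hξ₂) ∧
        (∀ c : IrrClass ((cmDatum L 2 (Matrix.of fun i j : Fin 2 => if i.val + j.val + 1 = 2 then (1 : L) else 0)).Local v),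
          c.IsConstituentOf (haveI := locallyCompactSpace_cmBorelU L 2 v; cmPrincipalSeries L 2 v
            (torusCharPair (conjLocal L (IsCMField.complexConj L) v) (cmLocalForm L 2 v) (cmLocalForm_eq_over L 2 v) 0
            ((torusLocalComponent L (IsCMField.complexConj L) v ξ.η).comp
                (quotConj (conjLocal L (IsCMField.complexConj L) v) (conjLocal_conjLocal_cm L v)) *
              halfModulusChar (UnitaryGroup.LocalRing L v))
            (torusLocalComponent L (IsCMField.complexConj L) v ξ.ψ))) ↔
            (c = IrrClass.mk (SmoothIrrep.ofChar ((ξ.xiLocalChar v).comp (MonoidHom.inl ((cmDatum L 2 (Matrix.of fun i j : Fin 2 => if i.val + j.val + 1 = 2 then (1 : L) else 0)).Local v) ((cmDatum L 1 (Matrix.of fun i j : Fin 1 => if i.val + j.val + 1 = 1 then (1 : L) else 0)).Local v))) hξ₂) ∨ c = πSt₂)) ∧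
        (∀ N₁ N₂ : Subrepresentation (haveI := locallyCompactSpace_cmBorelU L 2 v; cmPrincipalSeries L 2 v
            (torusCharPair (conjLocal L (IsCMField.complexConj L) v) (cmLocalForm L 2 v) (cmLocalForm_eq_over L 2 v) 0
            ((torusLocalComponent L (IsCMField.complexConj L) v ξ.η).comp
                (quotConj (conjLocal L (IsCMField.complexConj L) v) (conjLocal_conjLocal_cm L v)) *
              halfModulusChar (UnitaryGroup.LocalRing L v))
            (torusLocalComponent L (IsCMField.complexConj L) v ξ.ψ))),
          ¬ (⊥ < N₁ ∧ N₁ < N₂ ∧ N₂ < ⊤)) := by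
  intro L _ _ _ v ξ hns hξ₂
  haveI := locallyCompactSpace_cmBorelU L 2 v
  -- H1′: `r_B i(χH₂)` is finite-dimensional of dimension `≤ 2`
  have H1 := finiteDimensional_finrank_coinvariants_cmPrincipalSeries_two_le_two L v hns
    (torusCharPair (conjLocal L (IsCMField.complexConj L) v) (cmLocalForm L 2 v) (cmLocalForm_eq_over L 2 v) 0
      ((torusLocalComponent L (IsCMField.complexConj L) v ξ.η).comp
          (quotConj (conjLocal L (IsCMField.complexConj L) v) (conjLocal_conjLocal_cm L v)) *
        halfModulusChar (UnitaryGroup.LocalRing L v))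
      (torusLocalComponent L (IsCMField.complexConj L) v ξ.ψ))
  obtain ⟨hfd, h2⟩ := H1
  haveI := hfd
  -- H4: the `ξ₂`-quotient
  have HQ := hQ L v ξ hns
  obtain ⟨q, hq0, hq⟩ := HQ
  -- the dictionary `(ξ_v ∘ inl) g = η_v(det g) · ψ_v(det g)` (`det₁ 1 = 1`)
  have h1 : localDet (IsCMField.complexConj L) v (isUnit_antidiagOne_det L 1)
      (J := Matrix.of fun i j : Fin 1 => if i.val + j.val + 1 = 1 then (1 : L) else 0)
      (1 : ((cmDatum L 1 (Matrix.of fun i j : Fin 1 => if i.val + j.val + 1 = 1 then (1 : L) else 0)).Local v)) = 1 :=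
    map_one _
  have hdict : ∀ g : ↥(unitaryGroupOfForm (conjLocal L (IsCMField.complexConj L) v) (cmLocalForm L 2 v)),
      ((ξ.xiLocalChar v).comp (MonoidHom.inl ((cmDatum L 2 (Matrix.of fun i j : Fin 2 => if i.val + j.val + 1 = 2 then (1 : L) else 0)).Local v)
        ((cmDatum L 1 (Matrix.of fun i j : Fin 1 => if i.val + j.val + 1 = 1 then (1 : L) else 0)).Local v))) g =
      torusLocalComponent L (IsCMField.complexConj L) v ξ.η (localDet (IsCMField.complexConj L) v (isUnit_antidiagOne_det L 2) g) *
        torusLocalComponent L (IsCMField.complexConj L) v ξ.ψ (localDet (IsCMField.complexConj L) v (isUnit_antidiagOne_det L 2) g) := by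
    intro g
    rw [MonoidHom.comp_apply, MonoidHom.inl_apply, OneDimAutRepH.xiLocalChar_apply_eq]
    change torusLocalComponent L (IsCMField.complexConj L) v ξ.η (localDet (IsCMField.complexConj L) v (isUnit_antidiagOne_det L 2) g) *
        torusLocalComponent L (IsCMField.complexConj L) v ξ.ψ
          (localDet (IsCMField.complexConj L) v (isUnit_antidiagOne_det L 2) g *
            localDet (IsCMField.complexConj L) v (isUnit_antidiagOne_det L 1)
              (J := Matrix.of fun i j : Fin 1 => if i.val + j.val + 1 = 1 then (1 : L) else 0)
              (1 : ((cmDatum L 1 (Matrix.of fun i j : Fin 1 => if i.val + j.val + 1 = 1 then (1 : L) else 0)).Local v))) = _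
    rw [h1, mul_one]
  -- the generic assembly at `G₂` (instances at the `↥(unitaryGroupOfForm …)` spelling of ★ `cmBorelTriple`; the goal's `(cmDatum L 2 Φ₂).Local v`
  -- spelling is reached by `exact` through ★ `cmDatum_Local_eq` (`rfl`, delta on `cmDatum`))
  have key := IrrClass.exists_constituents_pair_of_quotient_char
    (cmBorelTriple L 2 v) (isLimitOfCompactOpen_cmBorelTriple_N L 2 v)
    (cmPrincipalSeries L 2 v
      (torusCharPair (conjLocal L (IsCMField.complexConj L) v) (cmLocalForm L 2 v) (cmLocalForm_eq_over L 2 v) 0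
        ((torusLocalComponent L (IsCMField.complexConj L) v ξ.η).comp
            (quotConj (conjLocal L (IsCMField.complexConj L) v) (conjLocal_conjLocal_cm L v)) *
          halfModulusChar (UnitaryGroup.LocalRing L v))
        (torusLocalComponent L (IsCMField.complexConj L) v ξ.ψ)))
    (Representation.isSmooth_smoothInd (cmBorelTriple L 2 v).P _)
    (hHC L v hns _) h2
    ((ξ.xiLocalChar v).comp (MonoidHom.inl ((cmDatum L 2 (Matrix.of fun i j : Fin 2 => if i.val + j.val + 1 = 2 then (1 : L) else 0)).Local v)
      ((cmDatum L 1 (Matrix.of fun i j : Fin 1 => if i.val + j.val + 1 = 1 then (1 : L) else 0)).Local v)))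
    hξ₂ q (fun g f => (hq g f).trans (congrArg (fun u : ℂˣ => (u : ℂ) * q f) (hdict g).symm)) hq0
    (fun f hf => hEig L v ξ hns f fun g => (hf g).trans (congrArg (fun u : ℂˣ => (u : ℂ) • f) (hdict g)))
  exact key

end Summit.HodgeConjecture.HodgeConjecture.Cruxes.H413.F0P3bU2PrincipalSeriesJHOfBricks

end
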